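import Summits.Ventures.HSemireg.ContractionRankPartialFourier
import Summits.Ventures.HSemireg.ContractionSpanThetaBox
import Summits.Ventures.HSemireg.AmplificationChainPridhamPerfect
import HarnessLib

/-!
# Venture HSemireg — the g = 6 METHOD INSTANCE of the signed verdict (THETA-SECANT `E_m ⊗ M` on the SPLIT sixfold
# component `(3, ℚ(√-d), split)`) as an IN-TREE CONDITIONAL THEOREM, with the census certificate «48 = 48» enclosed

HONEST FRAMING. Lean index of the computation cell `pub-hsemireg` (seat p8, «Sunday typer»). Nothing about any explicit variety
is asserted in the tree; every theorem below is an implication whose published inputs are hypotheses BY NAME and whose object and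
numbers are hypotheses BY VALUE. Nothing here says HC, HC_CM or HC_AV is proved. The SIGNED verdict `target-g6/VERDICT-G6.md`
v1.0 (sha256/16 `1651dcc7322662a2`, 2026-08-23T03:50:25Z) reads at g = 6: «NO-in-families-tried» on the deciding (non-split)
components, «candidates 0», and «YES as METHOD INSTANCES on the split components» (V-1, V-3, V-4). There is therefore NO g = 6
YES-candidate to type; this file types the one g = 6 object the verdict names as a YES — the METHOD INSTANCE of V-4:

  «THETA-SECANT `E_m ⊗ M` on `(3, ℚ(√-d), split)`, five fields (D-2…D-6: SEMIREG + CLASS, class ×3–×4, rank 48 = bound 48 ×4;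
  second CM points C14-3 48/48, 7/7)» — «SPLIT-component passes exist and print ONLY as METHOD INSTANCES, never as the g = 6
  answer» (V-3); DECIDING? «no (split; [Mar25 1.5.1] preprint / [Sch88/98] for d = 3)» (census D-2).

THE OBJECT BY VALUE (census `target-g6/CENSUS.md` v3.75 rows D-2…D-6; `step0/THETA-SECANT-p1.md` v2.6 §0–§2c): `X = J(C)` for a smooth
non-hyperelliptic genus-3 curve `C` (CM anchors of record: `J(Klein)`, `J(Fermat quartic)`, and the product structures `E_i³`, `E_ω³`),
`Θ` its principal polarisation, `D = C^{(2)} = Θ` the theta divisor, `𝓕_m = i_*𝒪_D(m·C_p)` (`m = 2, 4, 6, 8, 10`),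
`G_m = 𝓕_m^∨ ⊠ 𝓕_m` on `Y₀ = X × X` (a shifted sheaf), `E = Φ(G_m) ⊗ M_m` on the sixfold `P = X × X̂` (`Φ` = Orlov's equivalence,
`M_m` the untwisting line bundle); Weil structure `ψ₀ = J_{P_m}`, `ψ₀² = -(m² - 1) = -d`, `d ∈ {3, 15, 35, 63, 99}` (fields
`K = ℚ(√-d) = ℚ(√-3), ℚ(√-15), ℚ(√-35), ℚ(√-7), ℚ(√-11)`), signature `(3,3)`, on the SPLIT component; `ch₃(E) = a·h³ + b·w_re`
with `b = -1/3, -1/15, -1/35, -1/63, -1/99 ≠ 0` (CLASS ×3); CERTIFICATE: `r := rank(HT²(P) → H^•(P), ξ ↦ ξ ⌟ ch(E)) = 48` (66 operators,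
sub-ranks 15 / 27 / 15; exact, ×4 codes) AND the local-to-global / Künneth UPPER BOUND `dim Ext²(G_m, G_m) ≤ 1·6 + 6·6 + 6·1 = 48`
(`Ext⁰ = 1`), whence — by the printed identity `σ_E ∘ ob_E = (ξ ↦ ξ ⌟ ch E)` ([BuchweitzFlenner2008HH] Prop. 6.4.4, ON PAPER) —
`48 ≤ rank σ ≤ dim Ext² ≤ 48`: `ob_E` surjective,
`σ_E` INJECTIVE, `dim Ext² = 48` («rank 48 = bound 48»).

WHAT THE KERNEL HOLDS (theorems only; 0 `def`, 0 `sorry`, no new named fact): §1 the CLASS side of the certificate as kernel output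
of the class SHAPE — `r = 6n² − 2n` (`48` at `n = 3`) for the (twisted) THETA BOX of `ContractionSpanThetaBox.lean`, moved to the census
frame by seat p4's partial-Fourier transport and seat p6's twist invariance (th-7's `R₂(n)`, STRUCTURE C8); §2 the g = 6 ROW in seat p4's
TIER-2 currency (`PerfectComplexRankTransfer C`, the venture's ASSUMPTION by name; F-1: the kernel links it to nothing) and its two
consumers — the SPLIT SIXFOLDS `Stubs.WeilAlgebraicSplitHyperplane 3 d` (V-4's sentence) and, by Schoen's descent / the tree's ladder
(STRUCTURE §3.0), `WeilAlgebraicAll 2 d`, the Weil classes of EVERY `ℚ(√-d)`-Weil abelian FOURFOLD, every discriminant (in print: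
refereed for `d = 3` [Schoen1988HodgeWeil] + [Schoen1998HodgeWeilAddendum]; for the other four `d` only the PREPRINT [Markman2025SecantWeil]
Cor. 1.6.1); §3 the census certificate ENCLOSED — numeral forms (`hr : r = 48`, `h2 : dim Ext² ≤ 48` by value) and the form with `r = 48`
DERIVED from the class shape (§1), `h2` by value on the SOURCE `G` (p7's functor-free transport); §4 the trust-base ladder (`hT` from
`PridhamPerfectLifts C` ∧ `PerfectComplexAlgebraisesLifts C` ∧ `himp`; or theory seat 3's `hD.perfectComplexRankTransfer`).
BY NAME throughout: `weilFamilyReach_hyperbolic` (Deligne, refereed tree fact). Sources: [BuchweitzFlenner2008HH] Prop. 6.4.4;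
[Mukai1981] Thm. 2.2; [Orlov2002DerivedAbelian] Assertion 2.8; [Pridham2024Semiregularity] Cor. 2.25, Rem. 2.27; [Perry2022] Prop. 8.1;
[Deligne1982HodgeCycles] proof of Thm. 4.8; [Schoen1988HodgeWeil]; [Schoen1998HodgeWeilAddendum] §10; [Markman2025SecantWeil] Thm. 1.5.1,
Cor. 1.6.1 (preprint); [MumfordAV1970] §1 (4), §4 (iii).
-/

noncomputable section

open CategoryTheory AlgebraicGeometry Set
open CliffordAlgebra (contractLeft)
open ExteriorAlgebra (ι)
open Module
open Literature.AlgebraicGeometry.Motives Literature.AlgebraicGeometry.HodgeTheory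
open Literature.AlgebraicGeometry.ModuliOfAbelianVarieties Literature.AlgebraicGeometry.Deligne1982
open Literature.AlgebraicGeometry.KTheory
open Literature.AlgebraicTopology.SingularHomology

namespace Summit.Ventures.HSemireg

/-! ## §1 Class side of the certificate: `r = 6n² − 2n` for the twisted theta box, and its partial-Fourier transport -/

section ClassSide

variable {A : AbelianVariety ℂ} {V₁ V₂ L₁ L₂ : Submodule ℂ (complexBetti A.X 1)}

/-- **`r(A, κ) = 6n² − 2n` for a TWISTED theta-box class on an abelian `2n`-fold, `n ≥ 3`** (`= 48` at `n = 3`): as seat p6's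
`contractionRank_thetaBox`, but the total class of `κ` in `Λ H¹(A)` is the theta box `(a₁ + a₁'e^{c₁}) ∧ (a₂ + a₂'e^{c₂})` MULTIPLIED
by a twist `Σ_{k<N} cᵏ/k!`, `c ∈ span{v ∧ q : q ∈ H^{0,1}}`, `c^N = 0` — the shape of `ch(𝓕^∨ ⊠ 𝓕)` for secant-plane theta sheaves
`ch 𝓕 = A·e^{λΘ} + B·e^{λ'Θ}` (`= e^{λ'Θ}·(B + A·e^{(λ-λ')Θ})`), BY VALUE. Twist invariance is seat p6's `rank_span_mul_expSum_eq`.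
[cite: BuchweitzFlenner2008HH, Prop. 6.4.4] [cite: MumfordAV1970, §1 (4) and §4 (iii)] -/
theorem contractionRank_thetaBox_mul_expSum (hA : IsSmoothProjective A.dim A.X) (κ : ∀ p : ℕ, complexBetti A.X (2 * p))
    {n : ℕ} (hn : 3 ≤ n) (hV : IsCompl V₁ V₂) (b₁ : Module.Basis (Fin n ⊕ Fin n) ℂ V₁) (b₂ : Module.Basis (Fin n ⊕ Fin n) ℂ V₂)
    (hL : hodgeZeroOne hA = L₁ ⊔ L₂) (hL₁ : L₁ ≤ V₁) (hL₂ : L₂ ≤ V₂)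
    (hbL₁ : Submodule.span ℂ (Set.range (⇑b₁ ∘ Sum.inr)) = L₁.comap V₁.subtype)
    (hbL₂ : Submodule.span ℂ (Set.range (⇑b₂ ∘ Sum.inr)) = L₂.comap V₂.subtype) {N₁ N₂ : ℕ}
    (hN₁ : ExteriorLefschetz.twoVector b₁ ^ N₁ = 0) (hN₂ : ExteriorLefschetz.twoVector b₂ ^ N₂ = 0)
    {a₁ a₁' a₂ a₂' : ℂ} (ha₁ : a₁ ≠ 0) (ha₁' : a₁' ≠ 0) (ha₂ : a₂ ≠ 0) (ha₂' : a₂' ≠ 0)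
    {c : ExteriorAlgebra ℂ (complexBetti A.X 1)}
    (hc : c ∈ Submodule.span ℂ {z : ExteriorAlgebra ℂ (complexBetti A.X 1) |
      ∃ v : complexBetti A.X 1, ∃ q ∈ hodgeZeroOneSet A, z = ι ℂ v * ι ℂ q}) {N : ℕ} (hN : c ^ N = 0)
    (hx : totalExteriorClass A κ =
      ExteriorAlgebra.map V₁.subtype (algebraMap ℂ _ a₁ +
          a₁' • ∑ k ∈ Finset.range N₁, ((k.factorial : ℂ)⁻¹) • ExteriorLefschetz.twoVector b₁ ^ k) *
        ExteriorAlgebra.map V₂.subtype (algebraMap ℂ _ a₂ +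
          a₂' • ∑ k ∈ Finset.range N₂, ((k.factorial : ℂ)⁻¹) • ExteriorLefschetz.twoVector b₂ ^ k) *
        ∑ k ∈ Finset.range N, ((k.factorial : ℂ)⁻¹) • c ^ k) :
    contractionRank A κ = ((6 * n ^ 2 - 2 * n : ℕ) : Cardinal) := by
  haveI : Module.Finite ℂ (complexBetti A.X 1) := abelianVarietyCohomologyExteriorH1_holds.finite_one A
  haveI : FiniteDimensional ℂ (ExteriorAlgebra ℂ (complexBetti A.X 1)) :=
    ContractionSpan.finiteDimensional_exteriorAlgebra
  rw [contractionRank_eq_rank_span, hx,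
    ContractionSpan.rank_span_mul_expSum_eq (L := hodgeZeroOneSet A) (Θ := vectorFieldSet A) (fun _ hθ => hθ) hc hN,
    ← Module.finrank_eq_rank, vectorFieldSet_eq A hA rfl, ← coe_hodgeZeroOne_eq_hodgeZeroOneSet A hA rfl, hL,
    ContractionSpan.finrank_span_thetaBox hV hn b₁ b₂ hL₁ hL₂ hbL₁ hbL₂ hN₁ hN₂ ha₁ ha₁' ha₂ ha₂']

variable {A' : AbelianVariety ℂ}
variable {W₁ W₂ : Type} [AddCommGroup W₁] [Module ℂ W₁] [AddCommGroup W₂] [Module ℂ W₂] [FiniteDimensional ℂ W₂]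
variable {m : ℕ} (β₂ : Module.Basis (Fin m) ℂ W₂) (M₁ : Submodule ℂ W₁) (M₂ : Submodule ℂ W₂)

/-- **`r(A', κ'') = 6n² − 2n` for a class of THETA-SECANT type on a `2n`-fold target, `n ≥ 3`** (`48` at `n = 3`: the g = 6
method-instance rows D-2…D-6). Source: an abelian `2n`-fold `A` (for the cell: `X × X`, `X = J(C)` a genus-3 Jacobian) carrying a
class `κ` whose total class is a TWISTED THETA BOX in a splitting `H¹(A) = V₁ ⊕ V₂`, `H^{0,1}(A) = L₁ ⊕ L₂` with Darboux-type bases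
(BY VALUE — the sheared Künneth frame of `ch(μ_*(𝓕_m^∨ ⊠ 𝓕_m))`); transport BY VALUE along the PARTIAL Fourier transform (seat p4's
`contractionRank_eq_of_partialFourier_transport`: identifications `g`, `g'`, Hodge compatibilities `hM`, `hM'`, class identity `hF` —
Orlov's `Φ = (id × Φ_𝒫) ∘ μ_*` at class level) to `κ'` on `A'` (`= X × X̂`); then the target twist `Σ κ''_p = (Σ κ'_p) ∧ e^{c'}`,
`c' = c₁(M_m)` of type `span{v ∧ q : q ∈ H^{0,1}(A')}` (seat p6). Conclusion: `contractionRank A' κ'' = 6n² − 2n`. Same composition as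
seat p4's `contractionRank_eq_of_partialFourier_pointPairBox` with the theta box in place of the point-pair box.
[cite: BuchweitzFlenner2008HH, Prop. 6.4.4] [cite: Mukai1981, Thm. 2.2] [cite: Orlov2002DerivedAbelian, Assertion 2.8]
[cite: MumfordAV1970, §1 (4) and §4 (iii)] -/
theorem contractionRank_eq_of_partialFourier_thetaBox (hA : IsSmoothProjective A.dim A.X)
    (κ : ∀ p : ℕ, complexBetti A.X (2 * p)) (κ' κ'' : ∀ p : ℕ, complexBetti A'.X (2 * p)) {n : ℕ} (hn : 3 ≤ n)
    -- the twisted theta box on the source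
    (hV : IsCompl V₁ V₂) (b₁ : Module.Basis (Fin n ⊕ Fin n) ℂ V₁) (b₂ : Module.Basis (Fin n ⊕ Fin n) ℂ V₂)
    (hL : hodgeZeroOne hA = L₁ ⊔ L₂) (hL₁ : L₁ ≤ V₁) (hL₂ : L₂ ≤ V₂)
    (hbL₁ : Submodule.span ℂ (Set.range (⇑b₁ ∘ Sum.inr)) = L₁.comap V₁.subtype)
    (hbL₂ : Submodule.span ℂ (Set.range (⇑b₂ ∘ Sum.inr)) = L₂.comap V₂.subtype) {N₁ N₂ : ℕ}
    (hN₁ : ExteriorLefschetz.twoVector b₁ ^ N₁ = 0) (hN₂ : ExteriorLefschetz.twoVector b₂ ^ N₂ = 0)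
    {a₁ a₁' a₂ a₂' : ℂ} (ha₁ : a₁ ≠ 0) (ha₁' : a₁' ≠ 0) (ha₂ : a₂ ≠ 0) (ha₂' : a₂' ≠ 0)
    {c : ExteriorAlgebra ℂ (complexBetti A.X 1)}
    (hc : c ∈ Submodule.span ℂ {z : ExteriorAlgebra ℂ (complexBetti A.X 1) |
      ∃ v : complexBetti A.X 1, ∃ q ∈ hodgeZeroOneSet A, z = ι ℂ v * ι ℂ q}) {N : ℕ} (hN : c ^ N = 0)
    (hbox : totalExteriorClass A κ =
      ExteriorAlgebra.map V₁.subtype (algebraMap ℂ _ a₁ +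
          a₁' • ∑ k ∈ Finset.range N₁, ((k.factorial : ℂ)⁻¹) • ExteriorLefschetz.twoVector b₁ ^ k) *
        ExteriorAlgebra.map V₂.subtype (algebraMap ℂ _ a₂ +
          a₂' • ∑ k ∈ Finset.range N₂, ((k.factorial : ℂ)⁻¹) • ExteriorLefschetz.twoVector b₂ ^ k) *
        ∑ k ∈ Finset.range N, ((k.factorial : ℂ)⁻¹) • c ^ k)
    -- the partial Fourier transport to the target
    (g : complexBetti A.X 1 ≃ₗ[ℂ] W₁ × W₂) (g' : complexBetti A'.X 1 ≃ₗ[ℂ] W₁ × Module.Dual ℂ W₂)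
    (hM : ⇑g '' hodgeZeroOneSet A = (M₁.prod M₂ : Set (W₁ × W₂)))
    (hM' : ⇑g' '' hodgeZeroOneSet A' = (M₁.prod M₂.dualAnnihilator : Set (W₁ × Module.Dual ℂ W₂)))
    (hF : ExteriorAlgebra.map g'.toLinearMap (totalExteriorClass A' κ') =
      ContractionSpan.partialFourier β₂ (ExteriorAlgebra.map g.toLinearMap (totalExteriorClass A κ)))
    -- the twist on the target
    {c' : ExteriorAlgebra ℂ (complexBetti A'.X 1)}
    (hc' : c' ∈ Submodule.span ℂ {z : ExteriorAlgebra ℂ (complexBetti A'.X 1) |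
      ∃ v : complexBetti A'.X 1, ∃ q ∈ hodgeZeroOneSet A', z = ι ℂ v * ι ℂ q}) {N' : ℕ} (hN' : c' ^ N' = 0)
    (htw : totalExteriorClass A' κ'' = totalExteriorClass A' κ' * ∑ k ∈ Finset.range N', ((k.factorial : ℂ)⁻¹) • c' ^ k) :
    contractionRank A' κ'' = ((6 * n ^ 2 - 2 * n : ℕ) : Cardinal) := by
  rw [contractionRank_eq_of_totalExteriorClass_eq_mul_expSum A' hc' hN' htw,
    contractionRank_eq_of_partialFourier_transport β₂ M₁ M₂ A A' κ κ' g g' hM hM' hF]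
  exact contractionRank_thetaBox_mul_expSum hA κ hn hV b₁ b₂ hL hL₁ hL₂ hbL₁ hbL₂ hN₁ hN₂ ha₁ ha₁' ha₂ ha₂' hc hN hbox

end ClassSide

/-! ## §2 The g = 6 row in the TIER-2 currency: one hyperbolic seed of the rank class at level 3, and its two consumers -/

section Row

open Summit.HodgeConjecture.HodgeConjecture
open Summit.HodgeConjecture.HodgeConjecture.WeilTypeLadder
open Summit.HodgeConjecture.HodgeConjecture.Cruxes.HodgeAbelianVarieties.EStepSecantInduction
open Summit.Ventures.HSemireg.GeneralStructure

variable {C : ChernCharacterBetti}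

/-- **The g = 6 census row UNBUNDLED into seat p4's currency — every binder a real tree carrier.** A complex abelian SIXFOLD `P`
(`P.dim = 6`) with `ψ₀ ≫ ψ₀ = -d`, a projective embedding `e` and rational `a ≠ 0` such that `(P, ψ₀)` is of SPLIT (hyperbolic) Weil
type for `h_K = symmetrisedClass d P ψ₀ e a`; a non-zero rational class `w` of the Weil plane; Chern degrees `I ⊇ {1, …, 6}`; ONE
bounded complex of vector bundles `E` on `P.X` with `Ext^{<0}(E,E) = 0`, `Hom(E,E) = ℂ` (`extRank`) and
`rank Ext²(E,E) ≤ r(P, ch E)` (`contractionRank`); rationals `q`, `c_p` with `ch₃(E) = q·h_K³ + w`, `ch_p(E) = c_p·h_Kᵖ` off `3`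
⟹ `HasHyperbolicSeedOn (rankObjClass C) 3 d`. For the method instance by value: `P = X × X̂` (`X = J(C)`, genus 3),
`E = Φ(𝓕_m^∨ ⊠ 𝓕_m) ⊗ M_m`, `dim Ext² = 48 ≤ 48 = r`, `d ∈ {3, 15, 35, 63, 99}`. Nothing asserted.
[cite: BuchweitzFlenner2008HH, Prop. 6.4.4] [cite: vanGeemen1994HodgeAV, 5.2–5.4] -/
theorem hasHyperbolicSeedOn_rank_three_of_complex {d : ℕ}
    (P : AbelianVariety ℂ) (ψ₀ : P ⟶ P) (e : ProjectiveEmbedding P.X) (a : complexBetti (projectiveSpace e.n ℂ) 2)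
    (hP : P.dim = 2 * 3) (hψ : ψ₀ ≫ ψ₀ = -(d • 𝟙 P)) (ha : IsRationalClass a) (ha0 : a ≠ 0)
    (hhyp : IsHyperbolicWeilType P ψ₀ 3 (symmetrisedClass d P ψ₀ e a))
    (w : complexBetti P.X (2 * 3)) (hwW : w ∈ weilClassesOf P ψ₀ 3 d) (hwr : IsRationalClass w) (hw0 : w ≠ 0)
    (I : Finset ℕ) (hI : ∀ p : ℕ, 1 ≤ p → p ≤ 2 * 3 → p ∈ I) (E : CochainComplex P.X.left.Modules ℤ) (hE : IsBoundedVBComplex E)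
    (hneg : ∀ k : ℤ, k < 0 → extRank P.X E k = 0) (h0 : extRank P.X E 0 = 1)
    (h2 : extRank P.X E 2 ≤ Cardinal.lift.{1} (contractionRank P fun p ↦ chPerfect C P.X E hE.isFiniteLocallyFree p))
    (q : ℚ) (c : ℕ → ℚ)
    (hch3 : chPerfect C P.X E hE.isFiniteLocallyFree 3 = ((q : ℚ) : ℂ) • cupPowTwo (symmetrisedClass d P ψ₀ e a) 3 + w)
    (hchp : ∀ p ∈ I, p ≠ 3 →
      chPerfect C P.X E hE.isFiniteLocallyFree p = ((c p : ℚ) : ℂ) • cupPowTwo (symmetrisedClass d P ψ₀ e a) p) :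
    HasHyperbolicSeedOn (rankObjClass C) 3 d := by
  have hfun : (fun p ↦ complexBetti.map (Iso.refl P.X).hom (2 * p) (chPerfect C P.X E hE.isFiniteLocallyFree p)) =
      fun p ↦ chPerfect C P.X E hE.isFiniteLocallyFree p := by
    funext p
    rw [Iso.refl_hom, complexBetti.map_id]
    rfl
  have h2' : extRank P.X E 2 ≤ Cardinal.lift.{1} (contractionRank P fun p ↦
      complexBetti.map (Iso.refl P.X).hom (2 * p) (chPerfect C P.X E hE.isFiniteLocallyFree p)) := by
    rw [hfun]
    exact h2
  have hAdm : rankAdmissible C (2 * 3) P.X I E := ⟨hI, hneg, h0, P, Iso.refl P.X, hE, hP, h2'⟩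
  exact ⟨P, ψ₀, e, a, w, hP, hψ, ha, ha0, hhyp, hwW, hwr, hw0, I, fun p ↦ chPerfect C P.X E hE.isFiniteLocallyFree p, q, c,
    hI 3 (by norm_num) (by norm_num), ⟨E, hE, hAdm, fun _ _ ↦ rfl⟩, hch3, hchp⟩

/-- **g = 6 SPLIT — the verdict's METHOD INSTANCE as an in-tree conditional theorem (schema on the seed).** BY NAME:
`weilFamilyReach_hyperbolic` (Deligne, refereed fact); `PerfectComplexRankTransfer C` (seat p4's perfect-complex transfer for the REAL
rank class — an ASSUMPTION of the venture, of printed strength on paper by BF 2008 Prop. 6.4.4 + Perry 2022 Prop. 8.1 / Pridham 2024 /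
Lieblich 2006; the kernel links it to nothing, F-1); `0 < d`; ONE hyperbolic seed of class `rankObjClass C` at level `3`. Conclusion:
`Stubs.WeilAlgebraicSplitHyperplane 3 d` — the Weil classes of EVERY abelian sixfold of the SPLIT `ℚ(√-d)`-Weil component are algebraic
(in print: [Schoen1988HodgeWeil] for `d = 3`, refereed; [Markman2025SecantWeil] Thm. 1.5.1 for all `d`, PREPRINT; re-derived modulo the
named hypotheses; nothing about the non-split sixfold components — the verdict's deciding rows, «candidates 0»).
[cite: Markman2025SecantWeil, Thm. 1.5.1 (preprint)] [cite: Schoen1988HodgeWeil, Cor. 3.1 (K = ℚ(√-3))]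
[cite: Schoen1998HodgeWeilAddendum, §§11–13 (one sixfold family)]
[cite: BuchweitzFlenner2008HH, Prop. 6.4.4] [cite: Perry2022, Prop. 8.1] [cite: Deligne1982HodgeCycles, proof of Thm. 4.8] -/
theorem weilSixfoldsSplit_of_reach_of_perfectComplexRankTransfer_of_hyperbolicSeedOn (hF : weilFamilyReach_hyperbolic)
    (hT : PerfectComplexRankTransfer C) {d : ℕ} (hd : 0 < d) (hS : HasHyperbolicSeedOn (rankObjClass C) 3 d) :
    Stubs.WeilAlgebraicSplitHyperplane 3 d :=
  splitHyperplane_of_reach_of_perfectComplexVariationalHodge_of_hyperbolicSeedOn hF (by norm_num) hd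
    ((perfectComplexRankTransfer_iff C).1 hT) hS

/-- **THE LADDER from the g = 6 row — ALL `ℚ(√-d)`-Weil abelian FOURFOLDS** (STRUCTURE.md v1.0 §3.0: «a semiregular class-exact
secant box on the SPLIT component `(n, K, (−1)ⁿ·Nm)` … yields … algebraicity of the Weil classes on ALL Weil-type `2(n−1)`-folds with
field `K` (every discriminant class)»; Schoen's descent, the tree's `weilAlgebraicAll_of_…_lt`): reach ∧ `PerfectComplexRankTransfer C`
∧ ONE hyperbolic rank-class seed at level `3` ⟹ `WeilAlgebraicAll 2 d` — on EVERY complex abelian fourfold `A` with `φ ≫ φ = -d`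
(split AND non-split components, every discriminant) the rational `(2,2)`-classes of the Weil plane are algebraic. In print: refereed
for `d = 3` ([Schoen1988HodgeWeil] Thm. 3.2 + [Schoen1998HodgeWeilAddendum] Theorem p. 329); for general `d` only the PREPRINT
[Markman2025SecantWeil] Cor. 1.6.1. Re-derived modulo the named hypotheses from the cell's OWN sixfold object; nothing asserted.
[cite: Markman2025SecantWeil, Cor. 1.6.1 (preprint)] [cite: Schoen1988HodgeWeil, Thm. 3.2 (K = ℚ(√-3))]
[cite: Schoen1998HodgeWeilAddendum, Theorem p. 329 and Prop. 10 (every discriminant), §10 (descent)] [cite: Deligne1982HodgeCycles, proof of Thm. 4.8] -/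
theorem weilAlgebraicAll_two_of_reach_of_perfectComplexRankTransfer_of_hyperbolicSeedOn_three
    (hF : weilFamilyReach_hyperbolic) (hT : PerfectComplexRankTransfer C) {d : ℕ} (hd : 0 < d)
    (hS : HasHyperbolicSeedOn (rankObjClass C) 3 d) : WeilAlgebraicAll 2 d :=
  weilAlgebraicAll_of_reach_of_perfectComplexVariationalHodge_of_hyperbolicSeedOn_lt hF
    ((perfectComplexRankTransfer_iff C).1 hT) hS le_rfl (by norm_num) hd

/-- **g = 6, TIER 2, the census row UNBUNDLED** (g = 6 twin of seat p7's
`weilFourfoldsSplit_of_reach_of_perfectComplexRankTransfer_of_complex`): under `weilFamilyReach_hyperbolic` (refereed) and the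
ASSUMPTION `PerfectComplexRankTransfer C`, the binders of `hasHyperbolicSeedOn_rank_three_of_complex` (split CM sixfold anchor, `w`,
`I ⊇ {1..6}`, ONE bounded complex of vector bundles `E` with `Ext^{<0} = 0`, `Hom = ℂ`, `rank Ext² ≤ r(P, ch E)`, `ch₃ = q·h_K³ + w`,
`ch_p = c_p·h_Kᵖ` off `3`) give BOTH the split sixfolds `Stubs.WeilAlgebraicSplitHyperplane 3 d` AND all `ℚ(√-d)` fourfolds
`WeilAlgebraicAll 2 d`. [cite: Markman2025SecantWeil, Thm. 1.5.1 and Cor. 1.6.1 (preprint)] [cite: BuchweitzFlenner2008HH, Prop. 6.4.4]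
[cite: Perry2022, Prop. 8.1] [cite: Deligne1982HodgeCycles, proof of Thm. 4.8] -/
theorem weilSixfoldsSplit_and_fourfoldsAll_of_reach_of_perfectComplexRankTransfer_of_complex
    (hF : weilFamilyReach_hyperbolic) (hT : PerfectComplexRankTransfer C) {d : ℕ} (hd : 0 < d)
    (P : AbelianVariety ℂ) (ψ₀ : P ⟶ P) (e : ProjectiveEmbedding P.X) (a : complexBetti (projectiveSpace e.n ℂ) 2)
    (hP : P.dim = 2 * 3) (hψ : ψ₀ ≫ ψ₀ = -(d • 𝟙 P)) (ha : IsRationalClass a) (ha0 : a ≠ 0)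
    (hhyp : IsHyperbolicWeilType P ψ₀ 3 (symmetrisedClass d P ψ₀ e a))
    (w : complexBetti P.X (2 * 3)) (hwW : w ∈ weilClassesOf P ψ₀ 3 d) (hwr : IsRationalClass w) (hw0 : w ≠ 0)
    (I : Finset ℕ) (hI : ∀ p : ℕ, 1 ≤ p → p ≤ 2 * 3 → p ∈ I) (E : CochainComplex P.X.left.Modules ℤ) (hE : IsBoundedVBComplex E)
    (hneg : ∀ k : ℤ, k < 0 → extRank P.X E k = 0) (h0 : extRank P.X E 0 = 1)
    (h2 : extRank P.X E 2 ≤ Cardinal.lift.{1} (contractionRank P fun p ↦ chPerfect C P.X E hE.isFiniteLocallyFree p))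
    (q : ℚ) (c : ℕ → ℚ)
    (hch3 : chPerfect C P.X E hE.isFiniteLocallyFree 3 = ((q : ℚ) : ℂ) • cupPowTwo (symmetrisedClass d P ψ₀ e a) 3 + w)
    (hchp : ∀ p ∈ I, p ≠ 3 →
      chPerfect C P.X E hE.isFiniteLocallyFree p = ((c p : ℚ) : ℂ) • cupPowTwo (symmetrisedClass d P ψ₀ e a) p) :
    Stubs.WeilAlgebraicSplitHyperplane 3 d ∧ WeilAlgebraicAll 2 d :=
  have hS := hasHyperbolicSeedOn_rank_three_of_complex (C := C) P ψ₀ e a hP hψ ha ha0 hhyp w hwW hwr hw0 I hI E hE hneg h0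
    h2 q c hch3 hchp
  ⟨weilSixfoldsSplit_of_reach_of_perfectComplexRankTransfer_of_hyperbolicSeedOn hF hT hd hS,
    weilAlgebraicAll_two_of_reach_of_perfectComplexRankTransfer_of_hyperbolicSeedOn_three hF hT hd hS⟩

end Row

/-! ## §3 The census certificate ENCLOSED: «rank 48 = bound 48» -/

section Certificate

open Summit.HodgeConjecture.HodgeConjecture
open Summit.HodgeConjecture.HodgeConjecture.WeilTypeLadder
open Summit.HodgeConjecture.HodgeConjecture.Cruxes.HodgeAbelianVarieties.EStepSecantInduction
open Summit.Ventures.HSemireg.GeneralStructure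

variable {C : ChernCharacterBetti}

/-- **g = 6 METHOD INSTANCE, the certificate in NUMERAL form, both numbers BY VALUE** (the census words «rank r₀ = bound r₀»; for the
THETA-SECANT rows D-2…D-6 `r₀ = 48`, for the other split-component rank-certificate rows of V-4 their own number): `hr : r(P, ch E) = r₀` —
the census's EXACT rank of `HT²(P) → H^•(P)`, `ξ ↦ ξ ⌟ ch(E)` (theta-secant: 66 operators, `48`, ×4 codes: p1 `klein_htrank.py`, s0-1
`theta_rank.py`, ref `ref_theta_htrank_x2.py`, gs-eng-2 `theta_rank_gs2.py`; anchors `J(Klein)`, `J(Fermat)`, `E_i³`, `E_ω³`, the second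
CM points of C14-3) — and `h2 : dim Ext²(G, G) ≤ r₀` on the SOURCE object `G` over `Y₀` (theta-secant: `G_m = 𝓕_m^∨ ⊠ 𝓕_m` on `X × X`,
local-to-global + Künneth bound `1·6 + 6·6 + 6·1 = 48`), moved to `E` by p7's functor-free transport (`hext`: the `Ext`-ranks of `E` and
`G` agree in degrees `≤ 2` — Orlov's equivalence ∘ `⊗ M_m` by value), with `Ext^{<0}(G,G) = 0` (`hneg`, a shifted sheaf) and `Hom(G,G) = ℂ`
(`h0`). Conclusion, under `weilFamilyReach_hyperbolic` and `PerfectComplexRankTransfer C`: the split `ℚ(√-d)` sixfolds AND all `ℚ(√-d)`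
fourfolds. [cite: Markman2025SecantWeil, Thm. 1.5.1 and Cor. 1.6.1 (preprint)]
[cite: BuchweitzFlenner2008HH, Prop. 6.4.4] [cite: Orlov2002DerivedAbelian, Assertion 2.8] [cite: Deligne1982HodgeCycles, proof of Thm. 4.8] -/
theorem weilSixfoldsSplit_and_fourfoldsAll_of_reach_of_perfectComplexRankTransfer_of_certificate
    (hF : weilFamilyReach_hyperbolic) (hT : PerfectComplexRankTransfer C) {d : ℕ} (hd : 0 < d)
    (P : AbelianVariety ℂ) (ψ₀ : P ⟶ P) (e : ProjectiveEmbedding P.X) (a : complexBetti (projectiveSpace e.n ℂ) 2)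
    (hP : P.dim = 2 * 3) (hψ : ψ₀ ≫ ψ₀ = -(d • 𝟙 P)) (ha : IsRationalClass a) (ha0 : a ≠ 0)
    (hhyp : IsHyperbolicWeilType P ψ₀ 3 (symmetrisedClass d P ψ₀ e a))
    (w : complexBetti P.X (2 * 3)) (hwW : w ∈ weilClassesOf P ψ₀ 3 d) (hwr : IsRationalClass w) (hw0 : w ≠ 0)
    (I : Finset ℕ) (hI : ∀ p : ℕ, 1 ≤ p → p ≤ 2 * 3 → p ∈ I) (E : CochainComplex P.X.left.Modules ℤ) (hE : IsBoundedVBComplex E)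
    (q : ℚ) (c : ℕ → ℚ)
    (hch3 : chPerfect C P.X E hE.isFiniteLocallyFree 3 = ((q : ℚ) : ℂ) • cupPowTwo (symmetrisedClass d P ψ₀ e a) 3 + w)
    (hchp : ∀ p ∈ I, p ≠ 3 →
      chPerfect C P.X E hE.isFiniteLocallyFree p = ((c p : ℚ) : ℂ) • cupPowTwo (symmetrisedClass d P ψ₀ e a) p)
    -- the certificate: ONE number on both sides
    (r₀ : ℕ) (hr : contractionRank P (fun p ↦ chPerfect C P.X E hE.isFiniteLocallyFree p) = r₀)
    {Y₀ : SchemeOver ℂ} (G : CochainComplex Y₀.left.Modules ℤ)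
    (hext : ∀ n : ℤ, n ≤ 2 → extRank P.X E n = extRank Y₀ G n)
    (hneg : ∀ k : ℤ, k < 0 → extRank Y₀ G k = 0) (h0 : extRank Y₀ G 0 = 1) (h2 : extRank Y₀ G 2 ≤ r₀) :
    Stubs.WeilAlgebraicSplitHyperplane 3 d ∧ WeilAlgebraicAll 2 d := by
  refine weilSixfoldsSplit_and_fourfoldsAll_of_reach_of_perfectComplexRankTransfer_of_complex hF hT hd P ψ₀ e a hP hψ ha ha0
    hhyp w hwW hwr hw0 I hI E hE (fun k hk ↦ (hext k (by omega)).trans (hneg k hk)) ((hext 0 (by norm_num)).trans h0) ?_ q c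
    hch3 hchp
  rw [hext 2 le_rfl, hr, Cardinal.lift_natCast]
  exact h2

variable {W₁ W₂ : Type} [AddCommGroup W₁] [Module ℂ W₁] [AddCommGroup W₂] [Module ℂ W₂] [FiniteDimensional ℂ W₂]
variable {m : ℕ} (β₂ : Module.Basis (Fin m) ℂ W₂) (M₁ : Submodule ℂ W₁) (M₂ : Submodule ℂ W₂)
variable {Asrc : AbelianVariety ℂ} {V₁ V₂ L₁ L₂ : Submodule ℂ (complexBetti Asrc.X 1)}

/-- **g = 6 METHOD INSTANCE with `r(P, ch E) = 48` DERIVED IN THE KERNEL from the class shape** (§1 at `n = 3`) and only the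
OBJECT-side number `h2 : dim Ext²(G,G) ≤ 48` by value: the frame binders (source abelian sixfold `Asrc = X × X` with a TWISTED
THETA-BOX total class `κs` — `ch(μ_*(𝓕_m^∨ ⊠ 𝓕_m))` in the sheared Künneth frame —, the partial-Fourier transport `g, g', hM, hM', hF`
to the untwisted class `κ₀ = ch(Φ G_m)` on `P = X × X̂`, the target twist `htw` by `e^{c₁(M_m)}`) replace `hr`; everything else as in
`…_of_certificate`. BY NAME: `weilFamilyReach_hyperbolic`, `PerfectComplexRankTransfer C`. Conclusion: split `ℚ(√-d)` sixfolds AND all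
`ℚ(√-d)` fourfolds. [cite: Markman2025SecantWeil, Thm. 1.5.1 and Cor. 1.6.1 (preprint)] [cite: BuchweitzFlenner2008HH, Prop. 6.4.4]
[cite: Mukai1981, Thm. 2.2] [cite: Orlov2002DerivedAbelian, Assertion 2.8] [cite: Deligne1982HodgeCycles, proof of Thm. 4.8] -/
theorem weilSixfoldsSplit_and_fourfoldsAll_of_reach_of_perfectComplexRankTransfer_of_thetaSecant
    (hF' : weilFamilyReach_hyperbolic) (hT : PerfectComplexRankTransfer C) {d : ℕ} (hd : 0 < d)
    (P : AbelianVariety ℂ) (ψ₀ : P ⟶ P) (e : ProjectiveEmbedding P.X) (a : complexBetti (projectiveSpace e.n ℂ) 2)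
    (hP : P.dim = 2 * 3) (hψ : ψ₀ ≫ ψ₀ = -(d • 𝟙 P)) (ha : IsRationalClass a) (ha0 : a ≠ 0)
    (hhyp : IsHyperbolicWeilType P ψ₀ 3 (symmetrisedClass d P ψ₀ e a))
    (w : complexBetti P.X (2 * 3)) (hwW : w ∈ weilClassesOf P ψ₀ 3 d) (hwr : IsRationalClass w) (hw0 : w ≠ 0)
    (I : Finset ℕ) (hI : ∀ p : ℕ, 1 ≤ p → p ≤ 2 * 3 → p ∈ I) (E : CochainComplex P.X.left.Modules ℤ) (hE : IsBoundedVBComplex E)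
    (q : ℚ) (cq : ℕ → ℚ)
    (hch3 : chPerfect C P.X E hE.isFiniteLocallyFree 3 = ((q : ℚ) : ℂ) • cupPowTwo (symmetrisedClass d P ψ₀ e a) 3 + w)
    (hchp : ∀ p ∈ I, p ≠ 3 →
      chPerfect C P.X E hE.isFiniteLocallyFree p = ((cq p : ℚ) : ℂ) • cupPowTwo (symmetrisedClass d P ψ₀ e a) p)
    -- the object side of the certificate, on the source (BY VALUE)
    {Y₀ : SchemeOver ℂ} (G : CochainComplex Y₀.left.Modules ℤ)
    (hext : ∀ n : ℤ, n ≤ 2 → extRank P.X E n = extRank Y₀ G n)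
    (hneg : ∀ k : ℤ, k < 0 → extRank Y₀ G k = 0) (h0 : extRank Y₀ G 0 = 1) (h2 : extRank Y₀ G 2 ≤ 48)
    -- the twisted theta box on the source frame (BY VALUE)
    (hAsrc : IsSmoothProjective Asrc.dim Asrc.X) (κs : ∀ p : ℕ, complexBetti Asrc.X (2 * p))
    (hV : IsCompl V₁ V₂) (b₁ : Module.Basis (Fin 3 ⊕ Fin 3) ℂ V₁) (b₂ : Module.Basis (Fin 3 ⊕ Fin 3) ℂ V₂)
    (hL : hodgeZeroOne hAsrc = L₁ ⊔ L₂) (hL₁ : L₁ ≤ V₁) (hL₂ : L₂ ≤ V₂)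
    (hbL₁ : Submodule.span ℂ (Set.range (⇑b₁ ∘ Sum.inr)) = L₁.comap V₁.subtype)
    (hbL₂ : Submodule.span ℂ (Set.range (⇑b₂ ∘ Sum.inr)) = L₂.comap V₂.subtype) {N₁ N₂ : ℕ}
    (hN₁ : ExteriorLefschetz.twoVector b₁ ^ N₁ = 0) (hN₂ : ExteriorLefschetz.twoVector b₂ ^ N₂ = 0)
    {a₁ a₁' a₂ a₂' : ℂ} (ha₁ : a₁ ≠ 0) (ha₁' : a₁' ≠ 0) (ha₂ : a₂ ≠ 0) (ha₂' : a₂' ≠ 0)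
    {cs : ExteriorAlgebra ℂ (complexBetti Asrc.X 1)}
    (hcs : cs ∈ Submodule.span ℂ {z : ExteriorAlgebra ℂ (complexBetti Asrc.X 1) |
      ∃ v : complexBetti Asrc.X 1, ∃ q ∈ hodgeZeroOneSet Asrc, z = ι ℂ v * ι ℂ q}) {Ns : ℕ} (hNs : cs ^ Ns = 0)
    (hbox : totalExteriorClass Asrc κs =
      ExteriorAlgebra.map V₁.subtype (algebraMap ℂ _ a₁ +
          a₁' • ∑ k ∈ Finset.range N₁, ((k.factorial : ℂ)⁻¹) • ExteriorLefschetz.twoVector b₁ ^ k) *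
        ExteriorAlgebra.map V₂.subtype (algebraMap ℂ _ a₂ +
          a₂' • ∑ k ∈ Finset.range N₂, ((k.factorial : ℂ)⁻¹) • ExteriorLefschetz.twoVector b₂ ^ k) *
        ∑ k ∈ Finset.range Ns, ((k.factorial : ℂ)⁻¹) • cs ^ k)
    -- the transport and the untwisted target class (BY VALUE)
    (κ₀ : ∀ p : ℕ, complexBetti P.X (2 * p))
    (g : complexBetti Asrc.X 1 ≃ₗ[ℂ] W₁ × W₂) (g' : complexBetti P.X 1 ≃ₗ[ℂ] W₁ × Module.Dual ℂ W₂)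
    (hM : ⇑g '' hodgeZeroOneSet Asrc = (M₁.prod M₂ : Set (W₁ × W₂)))
    (hM' : ⇑g' '' hodgeZeroOneSet P = (M₁.prod M₂.dualAnnihilator : Set (W₁ × Module.Dual ℂ W₂)))
    (hF : ExteriorAlgebra.map g'.toLinearMap (totalExteriorClass P κ₀) =
      ContractionSpan.partialFourier β₂ (ExteriorAlgebra.map g.toLinearMap (totalExteriorClass Asrc κs)))
    -- the target twist (BY VALUE)
    {ct : ExteriorAlgebra ℂ (complexBetti P.X 1)}
    (hct : ct ∈ Submodule.span ℂ {z : ExteriorAlgebra ℂ (complexBetti P.X 1) |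
      ∃ v : complexBetti P.X 1, ∃ q ∈ hodgeZeroOneSet P, z = ι ℂ v * ι ℂ q}) {Nt : ℕ} (hNt : ct ^ Nt = 0)
    (htw : totalExteriorClass P (fun p ↦ chPerfect C P.X E hE.isFiniteLocallyFree p) =
      totalExteriorClass P κ₀ * ∑ k ∈ Finset.range Nt, ((k.factorial : ℂ)⁻¹) • ct ^ k) :
    Stubs.WeilAlgebraicSplitHyperplane 3 d ∧ WeilAlgebraicAll 2 d := by
  have hr : contractionRank P (fun p ↦ chPerfect C P.X E hE.isFiniteLocallyFree p) = ((48 : ℕ) : Cardinal) := by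
    have h := contractionRank_eq_of_partialFourier_thetaBox β₂ M₁ M₂ hAsrc κs κ₀ _ le_rfl hV b₁ b₂ hL hL₁ hL₂ hbL₁ hbL₂
      hN₁ hN₂ ha₁ ha₁' ha₂ ha₂' hcs hNs hbox g g' hM hM' hF hct hNt htw
    rw [h]
    norm_num
  exact weilSixfoldsSplit_and_fourfoldsAll_of_reach_of_perfectComplexRankTransfer_of_certificate hF' hT hd P ψ₀ e a hP hψ ha
    ha0 hhyp w hwW hwr hw0 I hI E hE q cq hch3 hchp 48 hr G hext hneg h0 (by exact_mod_cast h2)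

end Certificate

/-! ## §4 The trust base at g = 6: where `hT` comes from -/

section TrustBase

variable {C : ChernCharacterBetti}

/-- **Variant (P-cx) at the rank class — the split trust base of seat p7's Monday form, one `himp` away.** The PAIR
`PridhamPerfectLifts C` ([Pridham2024Semiregularity] Cor. 2.25 + Rem. 2.27 + Rem. 2.21 + Lemma 1.8–1.9 for strictly perfect complexes:
a PRINTED, REFEREED statement typed venture-side on the cell's real `σ`-carrier; hypothesis BY NAME, undischarged) ∧
`PerfectComplexAlgebraisesLifts C` (HODGE-FREE algebraisation, printed shape [Perry2022] proof of Prop. 8.1; kernel-linked to nothing)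
gives theory seat 3's étale assumption at the `σ`-class (PROVED, `AmplificationChainPridhamPerfect.lean` §2); adding the identity
`himp : rankAdmissible ⟹ sigmaAdmissible` ([BuchweitzFlenner2008HH] Prop. 6.4.4 «`σ_F(c_F ξ) = ξ ⌟ ch F`» with the squeeze
`r ≤ rank σ ≤ dim Ext² ≤ r` — ON PAPER, a HYPOTHESIS here; this is exactly the step the theta-secant certificate uses: its `σ`-injectivity
is INFERRED from «48 = 48», not computed) yields the rank transfer `hT` consumed by §2–§3. So the g = 6 method instance reads, finest
form: reach (refereed) ∧ (F) Pridham (printed, by name) ∧ (E)+(C) algebraisation (Hodge-free, by name) ∧ BF08 6.4.4 (by name) ∧ the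
theta-secant row BY VALUE ⟹ split `ℚ(√-d)` sixfolds ∧ all `ℚ(√-d)` fourfolds. [cite: Pridham2024Semiregularity, Cor. 2.25; Rem. 2.27]
[cite: Perry2022, proof of Prop. 8.1] [cite: BuchweitzFlenner2008HH, Prop. 6.4.4] -/
theorem perfectComplexRankTransfer_of_pridhamPerfect_of_algebraisesLifts_of_contractionIdentity (hP : PridhamPerfectLifts C)
    (hA : PerfectComplexAlgebraisesLifts C) (himp : ∀ n X₀ I E, rankAdmissible C n X₀ I E → sigmaAdmissible n X₀ I E) :
    PerfectComplexRankTransfer C :=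
  (perfectComplexDeformsOverEtaleNbhd_sigma_of_pridhamPerfect_of_algebraisesLifts hP hA).perfectComplexRankTransfer_of_sigma himp

end TrustBase

/-! ## Audit: nothing is decided here
KERNEL: §1 (`r = 6n² − 2n` for the twisted theta box, transported), §2 (seed packaging; split sixfolds; the fourfold ladder), §3 (the
numeral certificate composed; `r = 48` from the class shape), §4 (trust-base glue). BY VALUE: the split CM sixfold anchor, `w`, the Chern
data, the object `E` with `G`, `hext`, `hneg`, `h0`, the NUMBER `dim Ext²(G,G) ≤ 48`, and the NUMBER `r = 48` or §3's frame binders.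
BY NAME: `weilFamilyReach_hyperbolic` (refereed), `PerfectComplexRankTransfer C` (assumption; or §4). Not here: any non-split sixfold
(the verdict's deciding rows: «NO-in-families-tried», candidates 0), HC_CM, CM density, MT finiteness, `σ ∘ ob = ⌟ch` as a kernel fact. -/

end Summit.Ventures.HSemireg

end
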